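import Summits.BirchSwinnertonDyer.BirchSwinnertonDyer.Theorems.ResidualThetaTransportAtTwoSignedMuSeedAtTwoPlusTiltOrbitValuation
import Summits.BirchSwinnertonDyer.BirchSwinnertonDyer.Theorems.ResidualThetaTransportAtTwoUnramifiedQuadraticAtTwoBase
import HarnessLib

/-!
# Seed crux `SignedMuSeedAtTwoPlus` (stmt-BirchSwinnertonDyer-21438), line `norm-field-tilt`:
# the tilt engine over the line's ACTUAL base `ℤ₄ = 𝒪_{ℚ₂(ζ₃)}`, `π = −2`, residue field `𝔽₄`

Cell `bsd-wall`, width seat `bsd-wall-rtt-p4-w2` g10; twelfth file on the line, on top of p660062 (`…TiltOrbitValuation`) and the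
RTT base file `…UnramifiedQuadraticAtTwoBase` (rtt-p2 g9: `isLTRing_unitBall_adjoin_zeta : IsLTRing (−2) 4` for
`𝒪 := LubinTate.unitBall ℚ_[2]⟮ζ₃⟯`).  HONEST FRAMING: THEOREMS ONLY; closes no item; the line is NOT registered; BSD is NOT
proved by this.

## What is proved

For `𝒪 = 𝒪_{ℚ₂(ζ₃)} ⊂ ℚ̄₂` (`ζ² + ζ + 1 = 0`):
* `isUnit_of_norm_eq_one`, `norm_lt_one_of_mem_maximalIdeal`, `two_dvd_of_mem_maximalIdeal` — an element of `𝔪_𝒪` is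
  divisible by `2` (no ramification: `‖z‖ < 1 ⇒ ‖z‖ ≤ ‖2‖`, the tree's `norm_mem_adjoin_le_norm_two_of_lt_one`);
* **`span_neg_two_eq_maximalIdeal`** — `(−2) = 𝔪_𝒪`, hence **`isDomain_quotient_neg_two`**: `𝒪/(−2)` is an integral domain
  (indeed the field `𝔽₄`);
* **`oddDigit_of_nonDeg_zFour`** — the tilt engine (p660062's `oddDigit_of_nonDeg_theta`) over THIS base: for any
  Lubin–Tate series `f` for `(−2, 4)` over `𝒪` (e.g. `i([2]X)` of a model with `a_2 = 0`, RTT `isLTSeries_of_dvd`), a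
  Weierstrass model `U/𝒪` with `U.formalGroupLaw = F_f` and `a₁(U) ≡ 0 (mod 2)`, `g = 1 − 2·w₀` with `w₀, w₀ − 1 ∉ (2)`
  (`w̄₀ ∈ 𝔽₄ ∖ 𝔽₂`, i.e. `N(g) = −1`), a series `θ ∈ 𝔽₄⟦t̄⟧` of order `4` (`θ̄^ρ`), `Z_m = ∏_{j<2^m} θ([gʲ]‾t̄)`, `S_m` with
  `Z_m·S_m = η̄·Z_m'` and digits `Z_m ≡ P_m(s_m) (mod t̄^{3·4^m})`:
  **`ord S_{m₀} = a₀`, `a₀ + 2 < 4^{m₀+1}` ⟹ for every `m ≥ m₀ + 2` some odd-degree coefficient of `P_m` is non-zero.**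

The remaining inputs are exactly stub S1 proper (the model `U` of the CM curve `B/ℤ₄` with `U.formalGroupLaw = F_f`; `θ = θ̄^ρ`
from Robert's function; the membership / digits) and stub S4 (`NonDeg(m₀)`). [folklore]
-/

noncomputable section

set_option autoImplicit false
set_option linter.dupNamespace false

open scoped Classical IntermediateField
open PowerSeries
open Literature.NumberTheory.GaloisRepresentations
open Summit.BirchSwinnertonDyer.BirchSwinnertonDyer.Theorems.RelativeLubinTate.ZFour

namespace Summit.BirchSwinnertonDyer.BirchSwinnertonDyer.Theorems.SignedMuAtTwo.Tilt

variable {ζ : PadicAlgCl 2} (hζ : ζ ^ 2 + ζ + 1 = 0)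

/-- An element of `𝒪` of norm `1` is a unit of `𝒪`. [folklore] -/
theorem isUnit_of_norm_eq_one (z : LubinTate.unitBall (↥ℚ_[2]⟮ζ⟯)) (hz : ‖(z : ↥ℚ_[2]⟮ζ⟯)‖ = 1) : IsUnit z := by
  have hz0 : (z : ↥ℚ_[2]⟮ζ⟯) ≠ 0 := fun h => by rw [h, norm_zero] at hz; exact zero_ne_one hz
  have hinv : ‖((z : ↥ℚ_[2]⟮ζ⟯))⁻¹‖ ≤ 1 := by rw [norm_inv, hz, inv_one]
  refine isUnit_iff_exists_inv.mpr ⟨⟨((z : ↥ℚ_[2]⟮ζ⟯))⁻¹, (LubinTate.mem_unitBall_iff _).mpr hinv⟩, ?_⟩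
  apply Subtype.ext
  change (z : ↥ℚ_[2]⟮ζ⟯) * ((z : ↥ℚ_[2]⟮ζ⟯))⁻¹ = 1
  exact mul_inv_cancel₀ hz0

/-- Elements of the maximal ideal of `𝒪` have norm `< 1`. [folklore] -/
theorem norm_lt_one_of_mem_maximalIdeal {z : LubinTate.unitBall (↥ℚ_[2]⟮ζ⟯)}
    (hz : z ∈ IsLocalRing.maximalIdeal (LubinTate.unitBall (↥ℚ_[2]⟮ζ⟯))) : ‖(z : ↥ℚ_[2]⟮ζ⟯)‖ < 1 := by
  have hle : ‖(z : ↥ℚ_[2]⟮ζ⟯)‖ ≤ 1 := (LubinTate.mem_unitBall_iff _).mp z.2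
  rcases hle.lt_or_eq with h | h
  · exact h
  · exact absurd (isUnit_of_norm_eq_one z h) ((IsLocalRing.mem_maximalIdeal _).mp hz)

include hζ in
/-- **No ramification: `𝔪_𝒪 ⊆ (2)`** — every element of the maximal ideal of `𝒪 = 𝒪_{ℚ₂(ζ₃)}` is divisible by `2`.
[cite: SerreLocalFields1979, Ch. I §6] -/
theorem two_dvd_of_mem_maximalIdeal {z : LubinTate.unitBall (↥ℚ_[2]⟮ζ⟯)}
    (hz : z ∈ IsLocalRing.maximalIdeal (LubinTate.unitBall (↥ℚ_[2]⟮ζ⟯))) :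
    (2 : LubinTate.unitBall (↥ℚ_[2]⟮ζ⟯)) ∣ z := by
  have hlt := norm_lt_one_of_mem_maximalIdeal hz
  set zE : ↥ℚ_[2]⟮ζ⟯ := (z : ↥ℚ_[2]⟮ζ⟯) with hzE
  have hmem : (zE : PadicAlgCl 2) ∈ ℚ_[2]⟮ζ⟯ := zE.2
  have hlt' : ‖(zE : PadicAlgCl 2)‖ < 1 := by rw [← norm_coe_adjoin]; exact hlt
  have hle := norm_mem_adjoin_le_norm_two_of_lt_one hζ hmem hlt'
  have h2E : (2 : ↥ℚ_[2]⟮ζ⟯) ≠ 0 := by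
    intro h; have := congrArg norm h; rw [norm_two_adjoin, norm_zero] at this; norm_num at this
  have h2n : ‖((2 : ↥ℚ_[2]⟮ζ⟯) : PadicAlgCl 2)‖ = ‖(2 : PadicAlgCl 2)‖ := rfl
  set b : ↥ℚ_[2]⟮ζ⟯ := zE / 2 with hb
  have hb1 : ‖b‖ ≤ 1 := by
    rw [hb, norm_div, div_le_one (by rw [norm_two_adjoin]; norm_num), norm_coe_adjoin, norm_coe_adjoin, h2n]
    exact hle
  refine ⟨⟨b, (LubinTate.mem_unitBall_iff _).mpr hb1⟩, ?_⟩
  apply Subtype.ext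
  change zE = 2 * b
  rw [hb, mul_div_cancel₀ _ h2E]

include hζ in
/-- **`(−2) = 𝔪_𝒪`**: the ideal generated by `π = −2` is the maximal ideal of `𝒪_{ℚ₂(ζ₃)}`. [cite: SerreLocalFields1979, Ch. I §6] -/
theorem span_neg_two_eq_maximalIdeal :
    Ideal.span {-((2 : ℕ) : LubinTate.unitBall (↥ℚ_[2]⟮ζ⟯))} =
      IsLocalRing.maximalIdeal (LubinTate.unitBall (↥ℚ_[2]⟮ζ⟯)) := by
  apply le_antisymm
  · apply IsLocalRing.le_maximalIdeal
    rw [Ne, Ideal.span_singleton_eq_top, IsUnit.neg_iff, Nat.cast_ofNat]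
    exact not_isUnit_two
  · intro z hz
    rw [Ideal.mem_span_singleton, Nat.cast_ofNat]
    exact (neg_dvd).mpr (two_dvd_of_mem_maximalIdeal hζ hz)

include hζ in
/-- **`𝒪/(−2)` is an integral domain** (the residue field `𝔽₄`). [cite: SerreLocalFields1979, Ch. I §6] -/
theorem isDomain_quotient_neg_two :
    IsDomain (LubinTate.unitBall (↥ℚ_[2]⟮ζ⟯) ⧸ Ideal.span {-((2 : ℕ) : LubinTate.unitBall (↥ℚ_[2]⟮ζ⟯))}) := by
  have hmax : (Ideal.span {-((2 : ℕ) : LubinTate.unitBall (↥ℚ_[2]⟮ζ⟯))}).IsMaximal := by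
    rw [span_neg_two_eq_maximalIdeal hζ]; exact IsLocalRing.maximalIdeal.isMaximal _
  exact (Ideal.Quotient.isDomain_iff_prime _).mpr hmax.isPrime

/-- `2 = (−2)·(−1)` in `𝒪`, the shape `2 = π·c` of the unit tower. [folklore] -/
theorem two_eq_neg_two_mul :
    (2 : LubinTate.unitBall (↥ℚ_[2]⟮ζ⟯)) = -((2 : ℕ) : LubinTate.unitBall (↥ℚ_[2]⟮ζ⟯)) * (-1) := by
  rw [Nat.cast_ofNat]; ring

include hζ in
/-- `−1 ∉ (−2)` in `𝒪`. [folklore] -/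
theorem neg_one_not_mem_span_neg_two :
    (-1 : LubinTate.unitBall (↥ℚ_[2]⟮ζ⟯)) ∉ Ideal.span {-((2 : ℕ) : LubinTate.unitBall (↥ℚ_[2]⟮ζ⟯))} := by
  rw [span_neg_two_eq_maximalIdeal hζ, IsLocalRing.mem_maximalIdeal, mem_nonunits_iff, not_not]
  exact isUnit_one.neg

include hζ in
/-- **The tilt engine over `ℤ₄ = 𝒪_{ℚ₂(ζ₃)}`, `π = −2`** (p660062's `oddDigit_of_nonDeg_theta` with the base discharged: Lubin–Tate
ring `isLTRing_unitBall_adjoin_zeta`, residue domain `isDomain_quotient_neg_two`, `2 = π·(−1)`).  Inputs: a Lubin–Tate series `f`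
for `(−2, 4)` over `𝒪`; a Weierstrass model `U/𝒪` with `U.formalGroupLaw = F_f` and `a₁(U) ≡ 0 (mod 2)`; `g = 1 − 2·w₀` with
`w₀ ∉ (2)`, `w₀ − 1 ∉ (2)`; `θ ∈ (𝒪/2)⟦t̄⟧` of order `4`; `Z_m := ∏_{j<2^m} θ([gʲ]‾t̄)`, `S_m` with `Z_m·S_m = η̄·Z_m'`, digits
`Z_m ≡ P_m(s_m) (mod t̄^{3·4^m})`; `ord S_{m₀} = a₀` with `a₀ + 2 < 4^{m₀+1}`.  Output: for every `m ≥ m₀ + 2` some odd-degree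
coefficient of `P_m` is non-zero. [folklore] -/
theorem oddDigit_of_nonDeg_zFour {f : PowerSeries (LubinTate.unitBall (↥ℚ_[2]⟮ζ⟯))}
    (hf : LubinTate.IsLTSeries (-((2 : ℕ) : LubinTate.unitBall (↥ℚ_[2]⟮ζ⟯))) (2 ^ 2) f)
    (U : WeierstrassCurve (LubinTate.unitBall (↥ℚ_[2]⟮ζ⟯)))
    (hU : U.formalGroupLaw = LubinTate.ltF (isLTRing_unitBall_adjoin_zeta hζ) hf)
    (ha₁ : (U.map (Ideal.Quotient.mk (Ideal.span {-((2 : ℕ) : LubinTate.unitBall (↥ℚ_[2]⟮ζ⟯))}))).a₁ = 0)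
    {g w₀ : LubinTate.unitBall (↥ℚ_[2]⟮ζ⟯)} (hg : g = 1 + -((2 : ℕ) : LubinTate.unitBall (↥ℚ_[2]⟮ζ⟯)) * w₀)
    (hw₀ : w₀ ∉ Ideal.span {-((2 : ℕ) : LubinTate.unitBall (↥ℚ_[2]⟮ζ⟯))})
    (hw₀' : w₀ + (-1) ∉ Ideal.span {-((2 : ℕ) : LubinTate.unitBall (↥ℚ_[2]⟮ζ⟯))})
    {θ : PowerSeries (LubinTate.unitBall (↥ℚ_[2]⟮ζ⟯) ⧸ Ideal.span {-((2 : ℕ) : LubinTate.unitBall (↥ℚ_[2]⟮ζ⟯))})}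
    (hθ : θ.order = (4 : ℕ))
    (S s : ℕ → PowerSeries (LubinTate.unitBall (↥ℚ_[2]⟮ζ⟯) ⧸ Ideal.span {-((2 : ℕ) : LubinTate.unitBall (↥ℚ_[2]⟮ζ⟯))}))
    (P : ℕ → Polynomial (LubinTate.unitBall (↥ℚ_[2]⟮ζ⟯) ⧸ Ideal.span {-((2 : ℕ) : LubinTate.unitBall (↥ℚ_[2]⟮ζ⟯))}))
    (hZS : ∀ m, (∏ j ∈ Finset.range (2 ^ m),
        (θ.subst ((LubinTate.hom (isLTRing_unitBall_adjoin_zeta hζ) hf hf (g ^ j)).map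
          (Ideal.Quotient.mk (Ideal.span {-((2 : ℕ) : LubinTate.unitBall (↥ℚ_[2]⟮ζ⟯))}))) :
          PowerSeries (LubinTate.unitBall (↥ℚ_[2]⟮ζ⟯) ⧸ Ideal.span {-((2 : ℕ) : LubinTate.unitBall (↥ℚ_[2]⟮ζ⟯))}))) * S m =
      (U.map (Ideal.Quotient.mk (Ideal.span {-((2 : ℕ) : LubinTate.unitBall (↥ℚ_[2]⟮ζ⟯))}))).formalEta *
        d⁄dX (LubinTate.unitBall (↥ℚ_[2]⟮ζ⟯) ⧸ Ideal.span {-((2 : ℕ) : LubinTate.unitBall (↥ℚ_[2]⟮ζ⟯))})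
          (∏ j ∈ Finset.range (2 ^ m),
            (θ.subst ((LubinTate.hom (isLTRing_unitBall_adjoin_zeta hζ) hf hf (g ^ j)).map
              (Ideal.Quotient.mk (Ideal.span {-((2 : ℕ) : LubinTate.unitBall (↥ℚ_[2]⟮ζ⟯))}))) :
              PowerSeries (LubinTate.unitBall (↥ℚ_[2]⟮ζ⟯) ⧸ Ideal.span {-((2 : ℕ) : LubinTate.unitBall (↥ℚ_[2]⟮ζ⟯))}))))
    (hmem : ∀ m, (X : PowerSeries (LubinTate.unitBall (↥ℚ_[2]⟮ζ⟯) ⧸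
        Ideal.span {-((2 : ℕ) : LubinTate.unitBall (↥ℚ_[2]⟮ζ⟯))})) ^ (3 * 4 ^ m) ∣
      (∏ j ∈ Finset.range (2 ^ m),
        (θ.subst ((LubinTate.hom (isLTRing_unitBall_adjoin_zeta hζ) hf hf (g ^ j)).map
          (Ideal.Quotient.mk (Ideal.span {-((2 : ℕ) : LubinTate.unitBall (↥ℚ_[2]⟮ζ⟯))}))) :
          PowerSeries (LubinTate.unitBall (↥ℚ_[2]⟮ζ⟯) ⧸ Ideal.span {-((2 : ℕ) : LubinTate.unitBall (↥ℚ_[2]⟮ζ⟯))}))) -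
        Polynomial.aeval (s m) (P m))
    {m₀ a₀ : ℕ} (ha₀ : (S m₀).order = a₀) (hnd : a₀ + 2 < 4 ^ (m₀ + 1))
    {m : ℕ} (hm : m₀ + 2 ≤ m) : ∃ i, Odd i ∧ (P m).coeff i ≠ 0 := by
  haveI := isDomain_quotient_neg_two hζ
  exact oddDigit_of_nonDeg_theta (isLTRing_unitBall_adjoin_zeta hζ) hf (two_eq_neg_two_mul)
    (neg_one_not_mem_span_neg_two hζ) U hU ha₁ hg hw₀ hw₀' hθ S s P hZS hmem ha₀ hnd hm

end Summit.BirchSwinnertonDyer.BirchSwinnertonDyer.Theorems.SignedMuAtTwo.Tilt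

end
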